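import Summits.HodgeConjecture.HodgeConjecture.Theorems.PadicSemiregularLiftHodgeAbelianVarietiesPrymDefs
import Literature.AlgebraicGeometry.HodgeTheory.BlochSemiregularSpread

/-!
# Crux `HodgeAbelianVarieties` (stmt-HodgeConjecture-1333), line `prym-canonical-z3-split-seeds`: the SEED statement of
# stub 1 (gen 2, with the printed lci clause) and the proved composition "seed + Bloch ⟹ `PrymSpread`"

Companion of `Theorems/PadicSemiregularLiftHodgeAbelianVarietiesPrymDefs.lean` (vocabulary `IsSchoenPrymPair`, `symHyp`,
`pow4`, `PrymSpread`), kept in its own file because it imports the Literature module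
`HodgeTheory/BlochSemiregularSpread` (landed 2026-08-16: the named fact `BlochSemiregularSpread n p` = Bloch 1972 (7.4) /
Buchweitz–Flenner 2003 Thm 5.2 at `I = {p}` in anchored class-level form, and the regular-immersion predicate
`IsRegularImmersionOfCodim`). Contents:

* `SemiregularSchoenSeed` — the statement of the line's STUB 1 (its single bet; lead gen 2): a genus-5 `ℤ/3` Schoen–Prym
  pair `(P, ψ₀)`, hyperbolic for a `K`-symmetrised hyperplane class, carries an INTEGRAL closed LOCAL COMPLETE INTERSECTION
  `i : Z ↪ P` of codimension `4` (`IsRegularImmersionOfCodim i 4` — the gen-2 conjunct, Bloch's printed hypothesis) which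
  is Bloch-semiregular on the tree's real carrier (`IsBlochSemiregular i 8 4`) and supports a rational class `w + c·h_K⁴`
  with `w ≠ 0` in the Weil plane. An OPEN statement of the line (decided by the card's F2/F3 computation at Schoen's split
  Prym-canonical 4-fold `Z₀`); recorded as a definition so that helper files can prove implications from/to it; not a fact,
  not asserted, not a restatement of the crux (it sits three implications below it).
* `prymSpread_of_seed_of_bloch` (PROVED, registered sub-goal): STUB 1 + the named fact ⟹ `PrymSpread` — unpack the seed
  and feed Bloch's theorem at `(n, p) = (8, 4)` with `X₀ = P`, `x = w + c h_K⁴` to every anchored family.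

Sources for the notions: Schoen, Compositio 65 (1988) Thm 2.0, Lemma 2.6, Cor 3.1 (the intended witness `Z₀`);
Bloch 1972 / Buchweitz–Flenner 2003 (8.1), Prop 8.2 (semiregularity of lci subschemes); Görtz–Wedhorn Def 19.19 (regular
immersions).
-/

set_option linter.dupNamespace false

noncomputable section

open CategoryTheory AlgebraicGeometry
open Literature.AlgebraicGeometry Literature.AlgebraicGeometry.Motives
  Literature.AlgebraicGeometry.HodgeTheory Literature.Geometry.Kaehler

namespace Summit.HodgeConjecture.HodgeConjecture.Cruxes.HodgeAbelianVarieties.PrymCanonicalZ3SplitSeeds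

/-- **`SemiregularSchoenSeed`** — the statement of STUB 1 (the line's bet, F2/F3 of the card). There is a
genus-5 Schoen–Prym pair `(P, ψ₀)`, a projective embedding `e` and a non-zero rational `a ∈ H²(ℙᴺ)` for
which `(P, ψ₀)` is of HYPERBOLIC Weil type in half-dimension `4` for `h_K = 3e^*a + ψ₀^*e^*a`
(`IsHyperbolicWeilType`), an INTEGRAL scheme `Z` with a CLOSED IMMERSION `i : Z ↪ P` which is a REGULAR
IMMERSION OF CODIMENSION `4` (local complete intersection — gen-2 conjunct, the printed hypothesis of
Bloch's theorem, `Literature.AlgebraicGeometry.HodgeTheory.IsRegularImmersionOfCodim`) all of whose points have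
codimension `≥ 4` in `P`, such that
(a) `Z ⊂ P` is BLOCH-SEMIREGULAR in the ambient eightfold: `IsBlochSemiregular i 8 4` — surjectivity of the
Bloch pairing map `H³(P, Ω⁵_P) → H³(P, 𝓐lt₃(𝓘_Z; Ω⁸_P|_Z)) = H³(Z, Λ³𝒩 ⊗ ω_P)`, i.e. (Serre duality, BF
(8.1)(2)) injectivity of `π_Z : H¹(Z, 𝒩_{Z/P}) → H⁵(P, Ω³_P)` for `Z` a local complete intersection
(intended; no carrier for lci yet); and
(b) `Z` SUPPORTS a rational class `w + c·h_K⁴` with `w` a NON-ZERO class of the Weil plane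
`weilClassesOf P ψ₀ 4 3` (`w + c·h_K⁴ ∈ ker(H⁸(P) → H⁸(P ∖ Z))`; by purity this says
`cl(Z) ∈ ℂ h_K⁴ ⊕ W` with non-zero Weil component).
INTENDED WITNESS: Schoen's split Prym-canonical component `Z₀` (class in print, Cor. 3.1; (a) is OPEN and
is decided by the card's F2 (first order: `im(H⁰(N_{Z₀/𝒜}) → T𝒮) ⊋ T𝒫`?) and F3 (`dim ker π_{Z₀} = 0`)
at one explicit cover, e.g. the `(ℤ/3)²`-curve of TRIAGE r2-2). -/
def SemiregularSchoenSeed : Prop :=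
  ∃ (P : AbelianVariety ℂ) (ψ₀ : P ⟶ P) (e : ProjectiveEmbedding P.X)
    (a : complexBetti (projectiveSpace e.n ℂ) 2) (Z : Scheme.{0}) (i : Z ⟶ P.X.left)
    (w : complexBetti P.X (2 * 4)) (c : ℂ),
    IsSchoenPrymPair P ψ₀ ∧ IsRationalClass a ∧ a ≠ 0 ∧
    IsHyperbolicWeilType P ψ₀ 4 (symHyp ψ₀ e a) ∧
    IsClosedImmersion i ∧ IsRegularImmersionOfCodim i 4 ∧ IsIntegral Z ∧
    (∀ z ∈ Set.range i.base, ((4 : ℕ) : ℕ∞) ≤ Order.coheight z) ∧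
    IsBlochSemiregular i 8 4 ∧
    w ∈ weilClassesOf P ψ₀ 4 3 ∧ w ≠ 0 ∧
    IsRationalClass (w + c • pow4 (symHyp ψ₀ e a)) ∧
    w + c • pow4 (symHyp ψ₀ e a) ∈
      LinearMap.ker (complexBetti.restrictCompl P.X (Set.range i.base) (2 * 4)).hom

/-! ### Glue: seed + Bloch ⟹ `PrymSpread` -/

/-- **STUBS 1 + 2 ⟹ `PrymSpread`** (pure logic): unpack the seed, and for every anchored family feed
Bloch's theorem at `(n, p) = (8, 4)` with `X₀ = P`, `x = w + c h_K⁴`; the neighbourhood of `s₀` it returns is a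
non-empty open set of algebraicity. (The `√-3`-, irreducibility- and `H`-hypotheses of the inner clause are
not needed for this direction; they serve `stub_spreadClosing`.) -/
theorem prymSpread_of_seed_of_bloch :
    SemiregularSchoenSeed → (∀ n p : ℕ, Literature.AlgebraicGeometry.HodgeTheory.BlochSemiregularSpread n p) →
      PrymSpread := by
  intro hS hB
  obtain ⟨P, ψ₀, e, a, Z, i, w, c, hP, ha, ha0, hhyp, hci, hreg, hint, hcod, hsr, hw, hw0, hrat, hsupp⟩ := hS
  refine ⟨P, ψ₀, e, a, w, c, hP, ha, ha0, hhyp, hw, hw0, hrat, ?_⟩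
  intro 𝒳 S f s₀ e' W H hf h𝒳 hS hSm _ _ hW _ hWs₀ _
  obtain ⟨U, hU, hs₀, halg⟩ :=
    hB (2 * 4) 4 P.X Z i (w + c • pow4 (symHyp ψ₀ e a)) 𝒳 S f s₀ e' W hci hreg hint hcod hsr
      ((mem_classesSupportedOn_range_iff P.X i (2 * 4) _).2 hsupp) hf h𝒳 hS hSm hW hWs₀
  exact ⟨U, hU, ⟨s₀, hs₀⟩, halg⟩

end Summit.HodgeConjecture.HodgeConjecture.Cruxes.HodgeAbelianVarieties.PrymCanonicalZ3SplitSeeds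

end
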